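import Summits.CriticalPhenomena.CardyFormulaZ2.Theorems.CardyBoundaryCoulombGasStripClusterRatesConfinedGlueTransfer
import Summits.CriticalPhenomena.CardyFormulaZ2.Theorems.CardyBoundaryCoulombGasStripClusterRatesCardyOrderTwoLowerOfKacTwo
import HarnessLib

/-!
# The two-cluster half of `StripClusterRates` implies the CONFINED Cardy-order upper bound

Support file for line `two-cluster-rate-is-stationary-gap` (crux `StripClusterRates`,
stmt-CriticalPhenomena-13878), lead c8, stub `c8_confinedUpper_of_kacTwo` (T4b, "necessity of the confined
Cardy-order UPPER bound"); the confined twin of lead c7's `co_cardyOrderTwoLower_of_kacTwo`.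

Let `f(M,b)` be the probability (bond percolation on `ℤ²` at `p = 1/2`) of the END-CONFINED block event on
`[0,M]×[0,3b+2]` of lead c6's `…ConfinedGlueTransfer` (two end-confined open long crossings with their fences and an
end-confined dual-open long face crossing in between), and let `γ₂ : ℕ → ℝ` be a family of two-cluster rates in
TRANSFER-MATRIX order (`−log p₂(m,n)/m → γ₂(n)` for every width `n ≥ 1`) with the Kac limit `n·γ₂(n) → 2π`
(the γ₂-half of the crux). Then the confined event obeys a Cardy-order UPPER bound with exponent `2π`:

  `∃ g, g(A)/A → 2π ∧ ∀ A ≥ 1, ∀ᶠ b, f(A(3b+2), b) ≤ exp(−g(A))`.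

Proof. The confined gluing bound `cg_rateTwo_le_confined` (super-multiplicativity of `f` up to an absolute
constant and `f ≤ p₂`) gives an absolute `c ∈ (0,1]` with `γ₂(3b+2) ≤ (−log f(M,b) − log c)/(M + b + 2)` for
`b ≥ 3`, `M ≥ b+1`, `f(M,b) > 0`; since `γ₂ ≥ 0` (`co2l_rateTwo_nonneg`) this reads `log f(M,b) ≤ −log c − γ₂(n)·M`
(`n = 3b+2`). At `M = A·n` and `b` large one has `n·γ₂(n) ≥ 2π − 1/A`, hence
`log f ≤ −log c − 2πA + 1 = −g(A)` with `g(A) := 2πA + (log c − 1)`, and `g(A)/A → 2π`. If `f(A·n, b) = 0` the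
bound is trivial.

No definitions; `pTwo`, `rateSeqTwo` are the abbreviations of `Negative.KacFromAboveFalse`, and the registered form
`c8_confinedUpper_of_kacTwo` abstracts the confined probability as `f` exactly as `cg_rateTwo_le_confined` does.

References: [Cardy1998] eq. (bb); [Nolin2008] §4.3 Lemma 13.
-/

noncomputable section

open MeasureTheory Filter Topology Set
open Literature.Probability.LatticeModels Literature.Probability.Percolation
open Summit.CriticalPhenomena.CardyFormulaZ2.Theorems.StripClusterRates.Negative (pOne pTwo rateSeqTwo rateSeqOne)

namespace Summit.CriticalPhenomena.CardyFormulaZ2.Cruxes.StripClusterRates.TwoClusterRateIsStationaryGap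

/-! ## §1 Two elementary limits -/

/-- `g(A)/A → 2π` for `g(A) = 2πA + κ`. [folklore] -/
theorem cuk_tendsto_g_div (κ : ℝ) :
    Tendsto (fun A : ℕ ↦ (2 * Real.pi * A + κ) / A) atTop (𝓝 (2 * Real.pi)) := by
  refine cg_tendsto_add_const_div ?_ κ
  refine tendsto_const_nhds.congr' ?_
  filter_upwards [eventually_ge_atTop 1] with A hA
  have hA0 : (A : ℝ) ≠ 0 := by exact_mod_cast Nat.one_le_iff_ne_zero.mp hA
  field_simp

/-- Along the widths `n = 3b+2` the Kac limit gives `2π − 1/A ≤ (3b+2)·γ₂(3b+2)` eventually in `b`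
(`A ≥ 1`). [folklore] -/
theorem cuk_eventually_kac_ge {γ₂ : ℕ → ℝ}
    (hK : Tendsto (fun n : ℕ ↦ (n : ℝ) * γ₂ n) atTop (𝓝 (2 * Real.pi))) {A : ℕ} (hA : 1 ≤ A) :
    ∀ᶠ b : ℕ in atTop, 2 * Real.pi - 1 / (A : ℝ) ≤ ((3 * b + 2 : ℕ) : ℝ) * γ₂ (3 * b + 2) := by
  have hA' : (0 : ℝ) < A := by exact_mod_cast hA
  have hlt : 2 * Real.pi - 1 / (A : ℝ) < 2 * Real.pi := by
    have : (0 : ℝ) < 1 / (A : ℝ) := by positivity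
    linarith
  have h3 : Tendsto (fun b : ℕ ↦ 3 * b + 2) atTop atTop :=
    tendsto_atTop_mono (fun b : ℕ ↦ (by omega : b ≤ 3 * b + 2)) tendsto_id
  exact (hK.comp h3).eventually_const_le hlt

/-! ## §2 The confined Cardy-order upper bound with `g(A) = 2πA + (log c − 1)` -/

/-- **The γ₂-half of the crux implies the confined Cardy-order upper bound** (`f` abstracted as in
`cg_rateTwo_le_confined`): if `−log p₂(m,n)/m → γ₂(n)` for every width `n ≥ 1` and `n·γ₂(n) → 2π`, then
there is `g : ℕ → ℝ` with `g(A)/A → 2π` and, for every integer aspect ratio `A ≥ 1`,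
`f(A(3b+2), b) ≤ exp(−g(A))` eventually in `b` (`g(A) = 2πA + (log c − 1)` with the absolute gluing constant
`c` of `cg_rateTwo_le_confined`). [cite: Cardy1998, eq. (bb)] -/
theorem cuk_confinedUpper (f : ℕ → ℕ → ℝ)
    (hf : f = (fun M b : ℕ => (bondPercolation (zdGraph 2) half).real ((openCrossing {z ∈ (rectangle M (3 * b + 2) : Set (Site 2)) | (z 0 ≤ (b : ℤ) ∨ (M : ℤ) ≤ z 0 + b) → z 1 ≤ (b : ℤ)} (leftSide M (3 * b + 2) : Set (Site 2)) (rightSide M (3 * b + 2) : Set (Site 2)) ∩ tbCrossing b b ∩ openCrossing {z ∈ (rectangle M (3 * b + 2) : Set (Site 2)) | (z 0 ≤ (b : ℤ) ∨ (M : ℤ) ≤ z 0 + b) → 2 * (b : ℤ) + 2 ≤ z 1} (leftSide M (3 * b + 2) : Set (Site 2)) (rightSide M (3 * b + 2) : Set (Site 2)) ∩ (BondConfig.relabel (sym2Equiv (Site.shift (-pt 0 (2 * (b : ℤ) + 2))))) ⁻¹' tbCrossing b b) ∩ (dualConfig ⁻¹' openCrossing {z ∈ ((· + pt (-1) 0)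 '' (rectangle (M + 1) (3 * b + 1) : Set (Site 2))) | (z 0 ≤ (b : ℤ) ∨ (M : ℤ) ≤ z 0 + b) → (b : ℤ) + 1 ≤ z 1 ∧ z 1 ≤ 2 * (b : ℤ)} ((· + pt (-1) 0) '' (leftSide (M + 1) (3 * b + 1) : Set (Site 2))) ((· + pt (-1) 0) '' (rightSide (M + 1) (3 * b + 1) : Set (Site 2)))))))
    {γ₂ : ℕ → ℝ} (h₂ : ∀ n : ℕ, 1 ≤ n → Tendsto (rateSeqTwo n) atTop (𝓝 (γ₂ n)))
    (hK : Tendsto (fun n : ℕ ↦ (n : ℝ) * γ₂ n) atTop (𝓝 (2 * Real.pi))) :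
    ∃ g : ℕ → ℝ, Tendsto (fun A : ℕ ↦ g A / A) atTop (𝓝 (2 * Real.pi)) ∧
      ∀ A : ℕ, 1 ≤ A → ∀ᶠ b : ℕ in atTop, f (A * (3 * b + 2)) b ≤ Real.exp (-g A) := by
  obtain ⟨c, _, _, hrate⟩ := cg_rateTwo_le_confined
  refine ⟨fun A ↦ 2 * Real.pi * A + (Real.log c - 1), cuk_tendsto_g_div _, fun A hA ↦ ?_⟩
  have hA' : (0 : ℝ) < A := by exact_mod_cast hA
  filter_upwards [cuk_eventually_kac_ge hK hA, eventually_ge_atTop 3] with b hb hb3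
  have hM : b + 1 ≤ A * (3 * b + 2) := by nlinarith
  set n : ℕ := 3 * b + 2 with hn
  have hn1 : 1 ≤ n := by omega
  show f (A * n) b ≤ Real.exp (-(2 * Real.pi * A + (Real.log c - 1)))
  by_cases hfpos : 0 < f (A * n) b
  · have hbound := (le_div_iff₀ (by positivity)).1 (hrate f hf b (A * n) hb3 hM (γ₂ n) (h₂ n hn1) hfpos)
    have hγ0 : 0 ≤ γ₂ n := co2l_rateTwo_nonneg hn1 (h₂ n hn1)
    have h1 : γ₂ n * ((A * n : ℕ) : ℝ) ≤ γ₂ n * (((A * n : ℕ) : ℝ) + ((b + 2 : ℕ) : ℝ)) :=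
      mul_le_mul_of_nonneg_left (le_add_of_nonneg_right (by positivity)) hγ0
    have h2 : γ₂ n * ((A * n : ℕ) : ℝ) = (A : ℝ) * ((n : ℝ) * γ₂ n) := by push_cast; ring
    have h3 : (A : ℝ) * (2 * Real.pi - 1 / (A : ℝ)) ≤ (A : ℝ) * ((n : ℝ) * γ₂ n) :=
      mul_le_mul_of_nonneg_left hb hA'.le
    have h4 : (A : ℝ) * (2 * Real.pi - 1 / (A : ℝ)) = 2 * Real.pi * A - 1 := by
      rw [mul_sub, mul_one_div_cancel hA'.ne']; ring
    have hlog : Real.log (f (A * n) b) ≤ -(2 * Real.pi * A + (Real.log c - 1)) := by linarith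
    calc f (A * n) b = Real.exp (Real.log (f (A * n) b)) := (Real.exp_log hfpos).symm
      _ ≤ Real.exp (-(2 * Real.pi * A + (Real.log c - 1))) := Real.exp_le_exp.2 hlog
  · exact (not_lt.1 hfpos).trans (Real.exp_nonneg _)

/-- **Registered form** (stub `c8_confinedUpper_of_kacTwo` of stmt-CriticalPhenomena-13878, lead c8; T4b): with
`f(M,b)` the probability of the end-confined block event on `[0,M]×[0,3b+2]` and `γ₂` any family of
two-cluster rates with the Kac limit `n·γ₂(n) → 2π`, there is `g` with `g(A)/A → 2π` and
`f(A(3b+2), b) ≤ exp(−g(A))` eventually in `b`, for every `A ≥ 1` (= `cuk_confinedUpper`; the necessary half of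
the confined Cardy-order statement). [cite: Cardy1998, eq. (bb)] -/
theorem c8_confinedUpper_of_kacTwo : ∀ f : ℕ → ℕ → ℝ, f = (fun M b : ℕ => (bondPercolation (zdGraph 2) half).real ((openCrossing {z ∈ (rectangle M (3 * b + 2) : Set (Site 2)) | (z 0 ≤ (b : ℤ) ∨ (M : ℤ) ≤ z 0 + b) → z 1 ≤ (b : ℤ)} (leftSide M (3 * b + 2) : Set (Site 2)) (rightSide M (3 * b + 2) : Set (Site 2)) ∩ tbCrossing b b ∩ openCrossing {z ∈ (rectangle M (3 * b + 2) : Set (Site 2)) | (z 0 ≤ (b : ℤ) ∨ (M : ℤ) ≤ z 0 + b) → 2 * (b : ℤ) + 2 ≤ z 1} (leftSide M (3 * b + 2) : Set (Site 2)) (rightSide M (3 * b + 2) : Set (Site 2)) ∩ (BondConfig.relabel (sym2Equiv (Site.shift (-pt 0 (2 * (b : ℤ) + 2))))) ⁻¹' tbCrossing b b) ∩ (dualConfig ⁻¹' openCrossing {z ∈ ((· + pt (-1) 0) '' (rectangle (M + 1) (3 * b + 1) : Set (Site 2))) | (z 0 ≤ (b : ℤ) ∨ (M : ℤ) ≤ z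 0 + b) → (b : ℤ) + 1 ≤ z 1 ∧ z 1 ≤ 2 * (b : ℤ)} ((· + pt (-1) 0) '' (leftSide (M + 1) (3 * b + 1) : Set (Site 2))) ((· + pt (-1) 0) '' (rightSide (M + 1) (3 * b + 1) : Set (Site 2)))))) →
    ∀ γ₂ : ℕ → ℝ, (∀ n : ℕ, 1 ≤ n → Tendsto (rateSeqTwo n) atTop (𝓝 (γ₂ n))) →
    Tendsto (fun n : ℕ ↦ (n : ℝ) * γ₂ n) atTop (𝓝 (2 * Real.pi)) →
    ∃ g : ℕ → ℝ, Tendsto (fun A : ℕ ↦ g A / A) atTop (𝓝 (2 * Real.pi)) ∧ ∀ A : ℕ, 1 ≤ A → ∀ᶠ b : ℕ in atTop, f (A * (3 * b + 2)) b ≤ Real.exp (-g A) :=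
  fun f hf _ h₂ hK => cuk_confinedUpper f hf h₂ hK

end Summit.CriticalPhenomena.CardyFormulaZ2.Cruxes.StripClusterRates.TwoClusterRateIsStationaryGap

end
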